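import Mathlib
import Summits.ValiantsHypothesis.ValiantsHypothesis.Theorems.NewtonUnitEquationsNewtonTauWeakAutomatonDefs

/-!
# `NewtonUnitEquationsNewtonTauWeakAutomatonSupport` — carry automaton: support in the double box

Rung toward `stub_binomialNewtonTauCommon` (crux `NewtonTauWeak`, stmt-ValiantsHypothesis-5904), line
`binomial-normal-form`, CARRY-AUTOMATON rung: registered stub `stub_autoSupport`.

Claim.  Every exponent `e` in the support of the `K`-sum `hexSum K n c a b g` of digit-hexagon products with `n`
levels satisfies `e 0 < 2^(n+1)` and `e 1 < 2^(n+1)` (hypothesis `hsupp` of `stub_autoGreedy`).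

Proof.  Partial degrees (`MvPolynomial.degreeOf`): for `j ∈ {0, 1}` each binomial `1 - c • X^s` has
`degreeOf j ≤ s j` (`degreeOf_sub_le`, `degreeOf_one`, `degreeOf_C_mul_le`, `degreeOf_monomial_eq`), so the
level-`i` factor has `degreeOf j ≤ 2^i + 0 + 2^i = 2^(i+1)` (`degreeOf_mul_le`; the three exponent vectors are
`2^i·(1,0)`, `2^i·(0,1)`, `2^i·(1,1)`), the `n`-level product has `degreeOf j ≤ Σ_{i<n} 2^(i+1) = 2^(n+1) - 2`
(`degreeOf_prod_le`, geometric sum by induction), a scalar multiple does not increase it (`degreeOf_C_mul_le`),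
nor does the sum over the `K` products (`degreeOf_sum_le`, `Finset.sup_le`); finally `e j ≤ degreeOf j`
for `e` in the support (`monomial_le_degreeOf`). [folklore]
-/

set_option linter.dupNamespace false

noncomputable section

open scoped BigOperators
open MvPolynomial

namespace Summit.ValiantsHypothesis.ValiantsHypothesis.Theorems.NewtonTauWeakAutomaton

namespace AutoSupportAux

/-- A binomial `1 - a X^s` has partial degree in `X_j` at most `s j`. [folklore] -/
theorem degreeOf_one_sub_C_mul_monomial_le (j : Fin 2) (a : ℂ) (s : Fin 2 →₀ ℕ) :
    degreeOf j (1 - C a * monomial s (1 : ℂ) : MvPolynomial (Fin 2) ℂ) ≤ s j := by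
  refine (degreeOf_sub_le _ _ _).trans ?_
  rw [degreeOf_one]
  refine max_le (Nat.zero_le _) ((degreeOf_C_mul_le _ _ _).trans ?_)
  rw [degreeOf_monomial_eq _ _ one_ne_zero]

/-- The level-`i` factor `(1 - a x^{2^i})(1 - b y^{2^i})(1 - g (xy)^{2^i})` has partial degree at most
`2^(i+1)` in each variable. [folklore] -/
theorem degreeOf_hexFactor_le (j : Fin 2) (a b g : ℂ) (i : ℕ) :
    degreeOf j (hexFactor a b g i) ≤ 2 ^ (i + 1) := by
  unfold hexFactor
  refine (degreeOf_mul_le _ _ _).trans ?_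
  refine (add_le_add ((degreeOf_mul_le _ _ _).trans
    (add_le_add (degreeOf_one_sub_C_mul_monomial_le _ _ _) (degreeOf_one_sub_C_mul_monomial_le _ _ _)))
    (degreeOf_one_sub_C_mul_monomial_le _ _ _)).trans ?_
  fin_cases j <;> simp [pow_succ, mul_two]

/-- The geometric sum `Σ_{i<n} 2^(i+1) + 2 = 2^(n+1)`. -/
theorem sum_two_pow_succ_add_two (n : ℕ) : ∑ i ∈ Finset.range n, 2 ^ (i + 1) + 2 = 2 ^ (n + 1) := by
  induction n with
  | zero => simp
  | succ n ih =>
    rw [Finset.sum_range_succ, pow_succ 2 (n + 1)]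
    omega

/-- An `n`-level digit-hexagon product has partial degree at most `2^(n+1) - 2` in each variable. [folklore] -/
theorem degreeOf_hexProd_add_two_le (j : Fin 2) (a b g : ℕ → ℂ) (n : ℕ) :
    degreeOf j (hexProd a b g n) + 2 ≤ 2 ^ (n + 1) := by
  unfold hexProd
  rw [← sum_two_pow_succ_add_two n]
  refine Nat.add_le_add_right
    ((degreeOf_prod_le j (Finset.range n) fun i => hexFactor (a i) (b i) (g i) i).trans ?_) 2
  exact Finset.sum_le_sum fun i _ => degreeOf_hexFactor_le j (a i) (b i) (g i) i

/-- The `K`-sum of scalar multiples of `n`-level digit-hexagon products has partial degree at most `2^(n+1) - 2`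
in each variable. [folklore] -/
theorem degreeOf_hexSum_add_two_le (j : Fin 2) (K n : ℕ) (c : Fin K → ℂ) (a b g : Fin K → ℕ → ℂ) :
    degreeOf j (hexSum K n c a b g) + 2 ≤ 2 ^ (n + 1) := by
  have hpos : 2 ≤ 2 ^ (n + 1) := by
    have := degreeOf_hexProd_add_two_le j (fun _ => 0) (fun _ => 0) (fun _ => 0) n
    omega
  unfold hexSum
  have hsup : (Finset.univ.sup fun l : Fin K => degreeOf j (C (c l) * hexProd (a l) (b l) (g l) n)) ≤
      2 ^ (n + 1) - 2 := by
    refine Finset.sup_le fun l _ => (degreeOf_C_mul_le _ _ _).trans ?_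
    have := degreeOf_hexProd_add_two_le j (a l) (b l) (g l) n
    omega
  have := (degreeOf_sum_le j Finset.univ fun l : Fin K => C (c l) * hexProd (a l) (b l) (g l) n).trans hsup
  omega

end AutoSupportAux

open AutoSupportAux in
/-- **Support of a sum of digit-hexagon products lies in the double box.**  Every exponent vector `e` in the
support of `hexSum K n c a b g = Σ_l c_l · Π_{i<n} (1 - a_{l,i} x^{2^i})(1 - b_{l,i} y^{2^i})(1 - g_{l,i} (xy)^{2^i})`
satisfies `e 0 < 2^(n+1)` and `e 1 < 2^(n+1)` (indeed `≤ 2^(n+1) - 2`: the partial degrees of the level-`i`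
factor are `≤ 2^(i+1)` and `Σ_{i<n} 2^(i+1) = 2^(n+1) - 2`). [folklore: carry automaton / transfer matrices of
digit expansions] -/
theorem stub_autoSupport (K n : ℕ) (c : Fin K → ℂ) (a b g : Fin K → ℕ → ℂ) :
    ∀ e ∈ (hexSum K n c a b g).support, e 0 < 2 ^ (n + 1) ∧ e 1 < 2 ^ (n + 1) := by
  intro e he
  have key : ∀ j : Fin 2, e j < 2 ^ (n + 1) := by
    intro j
    have h1 : e j ≤ degreeOf j (hexSum K n c a b g) := monomial_le_degreeOf j he
    have h2 := degreeOf_hexSum_add_two_le j K n c a b g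
    omega
  exact ⟨key 0, key 1⟩

end Summit.ValiantsHypothesis.ValiantsHypothesis.Theorems.NewtonTauWeakAutomaton

end
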